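import Literature.NumberTheory.GelbartRogawski1991.LocalDoubledBlockEmbedding
import HarnessLib

-- as in the GelbartRogawski1991 siblings: elaborate sequentially (deterministic elaboration order for the large telescopes).
set_option Elab.async false

/-!
# The doubled block embedding, II: the doubling square, the four-fold shuffle, Siegel bookkeeping, normalisation transfer
# and movers of `ℓ_Δ`

Topic `NumberTheory/GelbartRogawski1991`; namespace
`Literature.NumberTheory.GelbartRogawski1991.UnitaryDualPair.LocalSplitting.DoubledBlock` (sequel of `LocalDoubledBlockEmbedding`:
`blkIdx`, `blkLoc`, `restrictBlk`, `boxLoc`).  KERNEL ONLY: theorems; no definition, no named fact, no `sorry`.  The local, one-place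
twin of the tree's adelic `DoubledBlockDiagEmbeddingDelta` / `DoubledSeesawParabolic` §7.0–§7.3 ([Kudla1994, §3 Thm. 3.1];
[HarrisKudlaSweet1996, §1 (1.11)–(1.16)]; [Kudla1984, §1]).

Setting as in `LocalDoubledBlockEmbedding`: `E/F` quadratic, a finite place `v`, `T = T₁ ⊕ᶠ T₂`, the doubled Gram matrices `gramD`.

* §1 **the doubling square** `U(V₁) → U(V₁ ⊥ V₂) → U(𝔻_{V₁ ⊥ V₂})` = `U(V₁) → U(𝔻_{V₁}) → U(𝔻_{V₁ ⊥ V₂})`: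
  `(g₁ ⊕ 1) ⊕ 1 = blkLoc (g₁ ⊕ 1)` (`inlLoc_inlLoc_eq_blkLoc_inlLoc`);
* §2 **the four-fold shuffle of product vectors** `(f₁ ⊠ f₂) ⊠ (f₃ ⊠ f₄) = (f₁ ⊠ f₃) ⊠_{blkIdx} (f₂ ⊠ f₄)` (`boxSB_boxSB_shuffle`);
* §3 Siegel bookkeeping of `blkLoc`: `deltaBlock_blkLoc`, **`detDelta_blkLoc`** (`det_Δ (blkLoc h)_w = det_Δ h_w`), **`chiDet_blkLoc`**,
  **`isSiegelDelta_blkLoc_iff`** (`blkLoc h ∈ P_Δ(T) ↔ h ∈ P_Δ(T₁)`);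
* §4 `s (blkLoc h) = j̃(restrictBlk s h, 1)` (`apply_blkLoc_eq_boxLoc`) and the **NORMALISATION TRANSFER** (`parabolic_restrictBlk`):
  a `P_Δ(T)`-normalisation of `s` for the box implementer `j̃(m₁, m₂)` with scalar `c` gives the `P_Δ(T₁)`-normalisation of
  `restrictBlk s` for `m₁` with scalar `c ∘ blkLoc` (test vector `Φ₁ ⊠ 1_𝒪`, `(Φ₁ ⊠ Φ₂)(0) = Φ₁(0) Φ₂(0)`);
* §5 Lagrangian bookkeeping: `ℓ_Δ(T) = ℓ_Δ(T₁) × ℓ_Δ(T₂)` and `ℓ_Y = ℓ_Y × ℓ_Y` through `splitW blkIdx`, hence **the box of two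
  movers of `ℓ_Δ` onto `ℓ_Y` is a mover** (`map_boxPair_deltaLagrangian`).

Consumer: `LocalSplittingCMBlockRestriction` (the local see-saw for the CM packages; cell `hodgecm-mathlib`, crux H413, N3 road (a), brick
(LS)).  HC_CM is NOT proved here and is proved only modulo the printed citations until rung 0 closes.

## References
* [Kudla1994] S. Kudla, Israel J. Math. 87 (1994), §2–§3, Thm. 3.1.
* [HarrisKudlaSweet1996] M. Harris, S. Kudla, W. Sweet, J. AMS 9 (1996), §1 (1.9)–(1.16).
* [Kudla1984] S. Kudla, Progr. Math. 46 (1984), §1.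
* [MoeglinVignerasWaldspurger1987] LNM 1291 (1987), Chap. 2 II.1 Rem. (6).
-/

set_option autoImplicit false

noncomputable section

open NumberField IsDedekindDomain Matrix
open Literature.RepresentationTheory.HeisenbergGroup
open Literature.NumberTheory.Automorphic Literature.NumberTheory.Weil1964

namespace Literature.NumberTheory.GelbartRogawski1991.UnitaryDualPair.LocalSplitting

namespace DoubledBlock

variable (F : Type) [Field F] [NumberField F] (E : Type) [Field E] [NumberField E] [Algebra F E] (c : E ≃ₐ[F] E)
  (v : HeightOneSpectrum (𝓞 F)) (n₁ n₂ : ℕ) {T₁ : Matrix (Fin n₁) (Fin n₁) F} {T₂ : Matrix (Fin n₂) (Fin n₂) F}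
  {JD₁ : Matrix (Fin (n₁ + n₁)) (Fin (n₁ + n₁)) E} (hJD₁ : JD₁ = (gramD F n₁ T₁).map (algebraMap F E))
  {JD : Matrix (Fin ((n₁ + n₂) + (n₁ + n₂))) (Fin ((n₁ + n₂) + (n₁ + n₂))) E}
  (hJD : JD = (gramD F (n₁ + n₂) (UnitaryGroup.finSum n₁ n₂ T₁ T₂)).map (algebraMap F E))
  [Algebra.IsQuadraticExtension F E] {δ : E} (hcδ : c δ = -δ) (hδ : δ ≠ 0) {d : F} (hd : δ * δ = algebraMap F E d)
  (hT₁ : T₁.IsSymm) (hT₂ : T₂.IsSymm) (hT₁d : IsUnit T₁.det) (hT₂d : IsUnit T₂.det)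

/-! ## §1 The doubling square: `(g₁ ⊕ 1) ⊕ 1 = blkLoc (g₁ ⊕ 1)` -/

section Square

variable {J₁ : Matrix (Fin n₁) (Fin n₁) E} (hJ₁ : J₁ = T₁.map (algebraMap F E))
  {J : Matrix (Fin (n₁ + n₂)) (Fin (n₁ + n₂)) E} (hJ : J = (UnitaryGroup.finSum n₁ n₂ T₁ T₂).map (algebraMap F E))

omit [Algebra.IsQuadraticExtension F E] in
/-- the matrix identity behind the doubling square: `e₂-reindex of (((finSumFinEquiv : Fin n₁ ⊕ Fin n₂ ≃ Fin (n₁ + n₂))-reindex of (M ⊕ 1)) ⊕ 1)` is the `blkIdx`-reindex of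
`((e₂-reindex of (M ⊕ 1)) ⊕ 1)`. [cite: Kudla1984, §1] [cite: Kudla1994, §2] -/
theorem reindex_fromBlocks_square {R : Type*} [Zero R] [One R] (M : Matrix (Fin n₁) (Fin n₁) R) :
    Matrix.reindex (e₂ (n₁ + n₂)) (e₂ (n₁ + n₂))
        (Matrix.fromBlocks (Matrix.reindex (finSumFinEquiv : Fin n₁ ⊕ Fin n₂ ≃ Fin (n₁ + n₂)) (finSumFinEquiv : Fin n₁ ⊕ Fin n₂ ≃ Fin (n₁ + n₂)) (Matrix.fromBlocks M 0 0 (1 : Matrix (Fin n₂) (Fin n₂) R))) 0 0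
          (1 : Matrix (Fin (n₁ + n₂)) (Fin (n₁ + n₂)) R)) =
      Matrix.reindex (blkIdx n₁ n₂) (blkIdx n₁ n₂)
        (Matrix.fromBlocks (Matrix.reindex (e₂ n₁) (e₂ n₁) (Matrix.fromBlocks M 0 0 (1 : Matrix (Fin n₁) (Fin n₁) R))) 0 0
          (1 : Matrix (Fin (n₂ + n₂)) (Fin (n₂ + n₂)) R)) := by
  -- compare after pulling back along `blkIdx`
  suffices h : (Matrix.reindex (e₂ (n₁ + n₂)) (e₂ (n₁ + n₂))
      (Matrix.fromBlocks (Matrix.reindex (finSumFinEquiv : Fin n₁ ⊕ Fin n₂ ≃ Fin (n₁ + n₂)) (finSumFinEquiv : Fin n₁ ⊕ Fin n₂ ≃ Fin (n₁ + n₂)) (Matrix.fromBlocks M 0 0 (1 : Matrix (Fin n₂) (Fin n₂) R))) 0 0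
        (1 : Matrix (Fin (n₁ + n₂)) (Fin (n₁ + n₂)) R))).submatrix (blkIdx n₁ n₂) (blkIdx n₁ n₂) =
      Matrix.fromBlocks (Matrix.reindex (e₂ n₁) (e₂ n₁) (Matrix.fromBlocks M 0 0 (1 : Matrix (Fin n₁) (Fin n₁) R))) 0 0
        (1 : Matrix (Fin (n₂ + n₂)) (Fin (n₂ + n₂)) R) by
    rw [← h, Matrix.reindex_apply (blkIdx n₁ n₂), Matrix.submatrix_submatrix, Equiv.self_comp_symm, Matrix.submatrix_id_id]
  ext a b
  rw [Matrix.submatrix_apply]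
  rcases a with a | a <;> rcases b with b | b
  · obtain ⟨a, rfl⟩ := (e₂ n₁).surjective a
    obtain ⟨b, rfl⟩ := (e₂ n₁).surjective b
    rcases a with a | a <;> rcases b with b | b <;>
      simp only [blkIdx_inl_inl, blkIdx_inl_inr, Matrix.reindex_apply, Matrix.submatrix_apply, Equiv.symm_apply_apply,
        Matrix.fromBlocks_apply₁₁, Matrix.fromBlocks_apply₁₂, Matrix.fromBlocks_apply₂₁, Matrix.fromBlocks_apply₂₂,
        Matrix.zero_apply, Matrix.one_apply, EmbeddingLike.apply_eq_iff_eq, Sum.inl.injEq]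
  · obtain ⟨a, rfl⟩ := (e₂ n₁).surjective a
    obtain ⟨b, rfl⟩ := (e₂ n₂).surjective b
    rcases a with a | a <;> rcases b with b | b <;>
      simp only [blkIdx_inl_inl, blkIdx_inl_inr, blkIdx_inr_inl, blkIdx_inr_inr, Matrix.reindex_apply,
        Matrix.submatrix_apply, Equiv.symm_apply_apply, Matrix.fromBlocks_apply₁₁, Matrix.fromBlocks_apply₁₂,
        Matrix.fromBlocks_apply₂₁, Matrix.fromBlocks_apply₂₂, Matrix.zero_apply, Matrix.one_apply,
        EmbeddingLike.apply_eq_iff_eq, reduceCtorEq, if_false]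
  · obtain ⟨a, rfl⟩ := (e₂ n₂).surjective a
    obtain ⟨b, rfl⟩ := (e₂ n₁).surjective b
    rcases a with a | a <;> rcases b with b | b <;>
      simp only [blkIdx_inl_inl, blkIdx_inl_inr, blkIdx_inr_inl, blkIdx_inr_inr, Matrix.reindex_apply,
        Matrix.submatrix_apply, Equiv.symm_apply_apply, Matrix.fromBlocks_apply₁₁, Matrix.fromBlocks_apply₁₂,
        Matrix.fromBlocks_apply₂₁, Matrix.fromBlocks_apply₂₂, Matrix.zero_apply, Matrix.one_apply,
        EmbeddingLike.apply_eq_iff_eq, reduceCtorEq, if_false]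
  · obtain ⟨a, rfl⟩ := (e₂ n₂).surjective a
    obtain ⟨b, rfl⟩ := (e₂ n₂).surjective b
    rcases a with a | a <;> rcases b with b | b <;>
      simp only [blkIdx_inr_inl, blkIdx_inr_inr, Matrix.reindex_apply, Matrix.submatrix_apply, Equiv.symm_apply_apply,
        Matrix.fromBlocks_apply₁₁, Matrix.fromBlocks_apply₁₂, Matrix.fromBlocks_apply₂₁, Matrix.fromBlocks_apply₂₂,
        Matrix.zero_apply, Matrix.one_apply, EmbeddingLike.apply_eq_iff_eq, Sum.inl.injEq, Sum.inr.injEq, reduceCtorEq,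
        if_false]

omit [Algebra.IsQuadraticExtension F E] in
/-- **THE DOUBLING SQUARE** `U(V₁) → U(V₁ ⊥ V₂) → U(𝔻_{V₁ ⊥ V₂})` = `U(V₁) → U(𝔻_{V₁}) → U(𝔻_{V₁ ⊥ V₂})`:
`(g₁ ⊕ 1) ⊕ 1 = blkLoc (g₁ ⊕ 1)` for `g₁ ∈ U(J₁)(F_v)`. [cite: Kudla1984, §1] [cite: Kudla1994, §2] -/
theorem inlLoc_inlLoc_eq_blkLoc_inlLoc (g₁ : UnitaryGroup.localPi E c n₁ J₁ v) :
    LocalSplitting.inlLoc F E c v (n₁ + n₂) hJ hJD (BlockSum.inlLoc F E c v n₁ n₂ hJ₁ hJ g₁) =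
      blkLoc F E c v n₁ n₂ hJD₁ hJD (LocalSplitting.inlLoc F E c v n₁ hJ₁ hJD₁ g₁) := by
  refine Subtype.ext (funext fun w => Units.ext ?_)
  rw [LocalSplitting.inlLoc_apply, BlockSum.inlLoc_apply, blkLoc_apply, LocalSplitting.inlLoc_apply,
    UnitaryGroup.coe_reindexGL, UnitaryGroup.coe_blockDiagGL, UnitaryGroup.coe_reindexGL, UnitaryGroup.coe_blockDiagGL,
    UnitaryGroup.coe_reindexGL, UnitaryGroup.coe_blockDiagGL, UnitaryGroup.coe_reindexGL, UnitaryGroup.coe_blockDiagGL,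
    Units.val_one, Units.val_one, Units.val_one, Units.val_one]
  exact reindex_fromBlocks_square n₁ n₂ _

end Square

/-! ## §2 The four-fold shuffle of products -/

omit [NumberField E] [Algebra.IsQuadraticExtension F E] in
/-- **`(f₁ ⊠ f₂) ⊠ (f₃ ⊠ f₄) = (f₁ ⊠ f₃) ⊠_{blkIdx} (f₂ ⊠ f₄)`** on `𝒮(F_v^{(n₁+n₂)+(n₁+n₂)})`: a product vector of the doubled
model of the sum is a product vector for the shuffled decomposition into the two doubled blocks.
[cite: MoeglinVignerasWaldspurger1987, Chap. 2 II.1 Rem. (6)] [cite: Kudla1994, §2] -/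
theorem boxSB_boxSB_shuffle (f₁ f₃ : SchwartzBruhat (Fin n₁ → (v.adicCompletion F))) (f₂ f₄ : SchwartzBruhat (Fin n₂ → (v.adicCompletion F))) :
    boxSB (v.adicCompletion F) (e₂ (n₁ + n₂)) (boxSB (v.adicCompletion F) (finSumFinEquiv : Fin n₁ ⊕ Fin n₂ ≃ Fin (n₁ + n₂)) f₁ f₂) (boxSB (v.adicCompletion F) (finSumFinEquiv : Fin n₁ ⊕ Fin n₂ ≃ Fin (n₁ + n₂)) f₃ f₄) =
      boxSB (v.adicCompletion F) (blkIdx n₁ n₂) (boxSB (v.adicCompletion F) (e₂ n₁) f₁ f₃) (boxSB (v.adicCompletion F) (e₂ n₂) f₂ f₄) := by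
  apply Subtype.ext
  funext x
  simp only [coe_boxSB]
  have h₁ : resL (finSumFinEquiv : Fin n₁ ⊕ Fin n₂ ≃ Fin (n₁ + n₂)) (resL (e₂ (n₁ + n₂)) x) = resL (e₂ n₁) (resL (blkIdx n₁ n₂) x) := funext fun i => by
    simp only [resL_apply, blkIdx_inl_inl]
  have h₂ : resR (finSumFinEquiv : Fin n₁ ⊕ Fin n₂ ≃ Fin (n₁ + n₂)) (resL (e₂ (n₁ + n₂)) x) = resL (e₂ n₂) (resR (blkIdx n₁ n₂) x) := funext fun j => by
    simp only [resL_apply, resR_apply, blkIdx_inr_inl]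
  have h₃ : resL (finSumFinEquiv : Fin n₁ ⊕ Fin n₂ ≃ Fin (n₁ + n₂)) (resR (e₂ (n₁ + n₂)) x) = resR (e₂ n₁) (resL (blkIdx n₁ n₂) x) := funext fun i => by
    simp only [resL_apply, resR_apply, blkIdx_inl_inr]
  have h₄ : resR (finSumFinEquiv : Fin n₁ ⊕ Fin n₂ ≃ Fin (n₁ + n₂)) (resR (e₂ (n₁ + n₂)) x) = resR (e₂ n₂) (resR (blkIdx n₁ n₂) x) := funext fun j => by
    simp only [resR_apply, blkIdx_inr_inr]
  rw [h₁, h₂, h₃, h₄, mul_mul_mul_comm]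

/-! ## §3 Siegel bookkeeping of the block embedding -/

section Siegel

omit [NumberField F] [NumberField E] [Algebra.IsQuadraticExtension F E] in
/-- `A.submatrix r c + B.submatrix r c = (A + B).submatrix r c` (applied form of `Matrix.submatrix_add`). [folklore] -/
private theorem submatrix_add' {l m o p R : Type*} [Add R] (A B : Matrix m p R) (r : l → m) (c' : o → p) :
    A.submatrix r c' + B.submatrix r c' = (A + B).submatrix r c' := rfl

omit [Algebra.IsQuadraticExtension F E] in
/-- the four `e₂`-blocks of `blkIdx-reindex (H ⊕ 1)` in terms of the `e₂`-blocks of `H`: each is the `(finSumFinEquiv : Fin n₁ ⊕ Fin n₂ ≃ Fin (n₁ + n₂))`-reindexed sum of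
the corresponding block of `H` with `1` (diagonal blocks) or `0` (off-diagonal blocks). [cite: Kudla1994, §3] -/
theorem toBlocks_reindex_blkIdx {R : Type*} [Zero R] [One R] (H : Matrix (Fin (n₁ + n₁)) (Fin (n₁ + n₁)) R) :
    (Matrix.reindex (e₂ (n₁ + n₂)).symm (e₂ (n₁ + n₂)).symm (Matrix.reindex (blkIdx n₁ n₂) (blkIdx n₁ n₂)
        (Matrix.fromBlocks H 0 0 (1 : Matrix (Fin (n₂ + n₂)) (Fin (n₂ + n₂)) R)))).toBlocks₁₁ =
        Matrix.reindex (finSumFinEquiv : Fin n₁ ⊕ Fin n₂ ≃ Fin (n₁ + n₂)) (finSumFinEquiv : Fin n₁ ⊕ Fin n₂ ≃ Fin (n₁ + n₂)) (Matrix.fromBlocks (Matrix.reindex (e₂ n₁).symm (e₂ n₁).symm H).toBlocks₁₁ 0 0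
          (1 : Matrix (Fin n₂) (Fin n₂) R)) ∧
      (Matrix.reindex (e₂ (n₁ + n₂)).symm (e₂ (n₁ + n₂)).symm (Matrix.reindex (blkIdx n₁ n₂) (blkIdx n₁ n₂)
        (Matrix.fromBlocks H 0 0 (1 : Matrix (Fin (n₂ + n₂)) (Fin (n₂ + n₂)) R)))).toBlocks₁₂ =
        Matrix.reindex (finSumFinEquiv : Fin n₁ ⊕ Fin n₂ ≃ Fin (n₁ + n₂)) (finSumFinEquiv : Fin n₁ ⊕ Fin n₂ ≃ Fin (n₁ + n₂)) (Matrix.fromBlocks (Matrix.reindex (e₂ n₁).symm (e₂ n₁).symm H).toBlocks₁₂ 0 0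
          (0 : Matrix (Fin n₂) (Fin n₂) R)) ∧
      (Matrix.reindex (e₂ (n₁ + n₂)).symm (e₂ (n₁ + n₂)).symm (Matrix.reindex (blkIdx n₁ n₂) (blkIdx n₁ n₂)
        (Matrix.fromBlocks H 0 0 (1 : Matrix (Fin (n₂ + n₂)) (Fin (n₂ + n₂)) R)))).toBlocks₂₁ =
        Matrix.reindex (finSumFinEquiv : Fin n₁ ⊕ Fin n₂ ≃ Fin (n₁ + n₂)) (finSumFinEquiv : Fin n₁ ⊕ Fin n₂ ≃ Fin (n₁ + n₂)) (Matrix.fromBlocks (Matrix.reindex (e₂ n₁).symm (e₂ n₁).symm H).toBlocks₂₁ 0 0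
          (0 : Matrix (Fin n₂) (Fin n₂) R)) ∧
      (Matrix.reindex (e₂ (n₁ + n₂)).symm (e₂ (n₁ + n₂)).symm (Matrix.reindex (blkIdx n₁ n₂) (blkIdx n₁ n₂)
        (Matrix.fromBlocks H 0 0 (1 : Matrix (Fin (n₂ + n₂)) (Fin (n₂ + n₂)) R)))).toBlocks₂₂ =
        Matrix.reindex (finSumFinEquiv : Fin n₁ ⊕ Fin n₂ ≃ Fin (n₁ + n₂)) (finSumFinEquiv : Fin n₁ ⊕ Fin n₂ ≃ Fin (n₁ + n₂)) (Matrix.fromBlocks (Matrix.reindex (e₂ n₁).symm (e₂ n₁).symm H).toBlocks₂₂ 0 0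
          (1 : Matrix (Fin n₂) (Fin n₂) R)) := by
  refine ⟨?_, ?_, ?_, ?_⟩
  all_goals
    refine (Matrix.reindex (finSumFinEquiv : Fin n₁ ⊕ Fin n₂ ≃ Fin (n₁ + n₂))
      (finSumFinEquiv : Fin n₁ ⊕ Fin n₂ ≃ Fin (n₁ + n₂))).symm.injective ?_
    rw [Equiv.symm_apply_apply, Matrix.reindex_symm, Matrix.reindex_apply, Equiv.symm_symm]
    ext a b
    rcases a with a | a <;> rcases b with b | b <;>
      simp only [Matrix.submatrix_apply, Matrix.toBlocks₁₁, Matrix.toBlocks₁₂, Matrix.toBlocks₂₁, Matrix.toBlocks₂₂,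
        Matrix.of_apply, Matrix.reindex_apply, Equiv.symm_symm, blkIdx_symm_inl_inl, blkIdx_symm_inr_inl,
        blkIdx_symm_inl_inr, blkIdx_symm_inr_inr, Matrix.fromBlocks_apply₁₁, Matrix.fromBlocks_apply₁₂,
        Matrix.fromBlocks_apply₂₁, Matrix.fromBlocks_apply₂₂, Matrix.zero_apply, Matrix.one_apply,
        EmbeddingLike.apply_eq_iff_eq, Sum.inl.injEq, Sum.inr.injEq, reduceCtorEq, if_false]

omit [Algebra.IsQuadraticExtension F E] in
/-- **the `Δ`-block of `blkLoc h` is `(Δ-block of h) ⊕ 1`**: `deltaBlock (blkLoc h)_w = (finSumFinEquiv : Fin n₁ ⊕ Fin n₂ ≃ Fin (n₁ + n₂))-reindex (deltaBlock h_w ⊕ 1)`.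
[cite: Kudla1994, §3] [cite: HarrisKudlaSweet1996, §1 (1.15)] -/
theorem deltaBlock_blkLoc (h : UnitaryGroup.localPi E c (n₁ + n₁) JD₁ v) (w : UnitaryGroup.PlacesOver E v) :
    deltaBlock F E c v (n₁ + n₂) w (blkLoc F E c v n₁ n₂ hJD₁ hJD h) =
      Matrix.reindex (finSumFinEquiv : Fin n₁ ⊕ Fin n₂ ≃ Fin (n₁ + n₂)) (finSumFinEquiv : Fin n₁ ⊕ Fin n₂ ≃ Fin (n₁ + n₂)) (Matrix.fromBlocks (deltaBlock F E c v n₁ w h) 0 0 (1 : Matrix (Fin n₂) (Fin n₂) (w.1.adicCompletion E))) := by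
  have hX := toBlocks_reindex_blkIdx n₁ n₂
    ((((h : UnitaryGroup.LocalGLPi E (n₁ + n₁) v) w : GL (Fin (n₁ + n₁)) (w.1.adicCompletion E)) :
      Matrix (Fin (n₁ + n₁)) (Fin (n₁ + n₁)) (w.1.adicCompletion E)))
  simp only [deltaBlock, blkLoc_apply, UnitaryGroup.coe_reindexGL, UnitaryGroup.coe_blockDiagGL, Units.val_one]
  rw [hX.1, hX.2.1]
  simp only [Matrix.reindex_apply, Equiv.symm_symm]
  rw [submatrix_add', Matrix.fromBlocks_add, add_zero, add_zero, add_zero]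

omit [Algebra.IsQuadraticExtension F E] in
/-- **`det_Δ (blkLoc h)_w = det_Δ h_w`** for every `w ∣ v`. [cite: Kudla1994, §3] [cite: HarrisKudlaSweet1996, §1 (1.15)] -/
theorem detDelta_blkLoc (h : UnitaryGroup.localPi E c (n₁ + n₁) JD₁ v) (w : UnitaryGroup.PlacesOver E v) :
    detDelta F E c v (n₁ + n₂) w (blkLoc F E c v n₁ n₂ hJD₁ hJD h) = detDelta F E c v n₁ w h := by
  rw [detDelta, detDelta, deltaBlock_blkLoc, Matrix.det_reindex_self, Matrix.det_fromBlocks_zero₂₁, Matrix.det_one, mul_one]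

omit [Algebra.IsQuadraticExtension F E] in
/-- **`χ_v(det_Δ (blkLoc h)) = χ_v(det_Δ h)`** for every family of local characters. [cite: HarrisKudlaSweet1996, §1 (1.15)] -/
theorem chiDet_blkLoc (χv : ∀ w : UnitaryGroup.PlacesOver E v, (w.1.adicCompletion E)ˣ →* ℂˣ)
    (h : UnitaryGroup.localPi E c (n₁ + n₁) JD₁ v) :
    chiDet F E c v (n₁ + n₂) χv (blkLoc F E c v n₁ n₂ hJD₁ hJD h) = chiDet F E c v n₁ χv h := by
  unfold chiDet
  refine Finset.prod_congr rfl fun w _ => ?_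
  by_cases hu : IsUnit (detDelta F E c v n₁ w h)
  · have hu' : IsUnit (detDelta F E c v (n₁ + n₂) w (blkLoc F E c v n₁ n₂ hJD₁ hJD h)) := by rwa [detDelta_blkLoc]
    rw [dif_pos hu', dif_pos hu]
    congr 1
    exact Units.ext (by rw [IsUnit.unit_spec, IsUnit.unit_spec, detDelta_blkLoc])
  · have hu' : ¬ IsUnit (detDelta F E c v (n₁ + n₂) w (blkLoc F E c v n₁ n₂ hJD₁ hJD h)) := by rwa [detDelta_blkLoc]
    rw [dif_neg hu', dif_neg hu]

/-- **`blkLoc h ∈ P_Δ(T) ↔ h ∈ P_Δ(T₁)`**: the block condition `h₁₁ + h₁₂ = h₂₁ + h₂₂` of the doubled sum at `blkLoc h` is the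
block condition of `h` (the extra blocks are `1 + 0 = 0 + 1`). [cite: Kudla1994, §3] [cite: HarrisKudlaSweet1996, §1 (1.11)] -/
theorem isSiegelDelta_blkLoc_iff (h : UnitaryGroup.localPi E c (n₁ + n₁) JD₁ v) :
    IsSiegelDelta F E c hcδ hδ hd v (n₁ + n₂) (UnitaryGroup.isSymm_finSum hT₁ hT₂) hJD (blkLoc F E c v n₁ n₂ hJD₁ hJD h) ↔
      IsSiegelDelta F E c hcδ hδ hd v n₁ hT₁ hJD₁ h := by
  rw [isSiegelDelta_iff_blocks, isSiegelDelta_iff_blocks]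
  refine forall_congr' fun w => ?_
  have hX := toBlocks_reindex_blkIdx n₁ n₂
    ((((h : UnitaryGroup.LocalGLPi E (n₁ + n₁) v) w : GL (Fin (n₁ + n₁)) (w.1.adicCompletion E)) :
      Matrix (Fin (n₁ + n₁)) (Fin (n₁ + n₁)) (w.1.adicCompletion E)))
  simp only [blkLoc_apply, UnitaryGroup.coe_reindexGL, UnitaryGroup.coe_blockDiagGL, Units.val_one]
  rw [hX.1, hX.2.1, hX.2.2.1, hX.2.2.2]
  simp only [Matrix.reindex_apply, Equiv.symm_symm]
  rw [submatrix_add', submatrix_add', Matrix.fromBlocks_add, Matrix.fromBlocks_add, add_zero, add_zero, add_zero, zero_add]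
  constructor
  · intro heq
    exact (Matrix.fromBlocks_inj.1 ((Matrix.reindex (finSumFinEquiv : Fin n₁ ⊕ Fin n₂ ≃ Fin (n₁ + n₂))
      (finSumFinEquiv : Fin n₁ ⊕ Fin n₂ ≃ Fin (n₁ + n₂))).injective heq)).1
  · intro heq
    rw [heq]

end Siegel


/-! ## §4 `s (blkLoc h) = j̃(restrictBlk s h, 1)` and the normalisation transfer -/

section Transfer

variable (s : UnitaryGroup.localPi E c ((n₁ + n₂) + (n₁ + n₂)) JD v →*
    LocalMp F ((n₁ + n₂) + (n₁ + n₂)) (gramD F (n₁ + n₂) (UnitaryGroup.finSum n₁ n₂ T₁ T₂)) v)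
  (hs : ∀ h, MpPsi.proj _ (s h) = iota F E c ((n₁ + n₂) + (n₁ + n₂)) hcδ hδ hd (gramD F (n₁ + n₂) (UnitaryGroup.finSum n₁ n₂ T₁ T₂))
    (gramD_isSymm F (n₁ + n₂) (UnitaryGroup.isSymm_finSum hT₁ hT₂)) hJD v h)

set_option maxHeartbeats 1600000 in -- `LocalMp` vs `MpPsi (schrodingerSB …)` unification at the doubled models
/-- **`s (blkLoc h) = j̃(restrictBlk s h, 1)`** in `S̃p(𝕎^𝔻_T)`: same projection (`spInl (ι^𝔻_{T₁} h) · spInr 1`) and same operator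
on every product vector. [cite: MoeglinVignerasWaldspurger1987, Chap. 2 II.1 Rem. (6)] [cite: Kudla1994, §3] -/
theorem apply_blkLoc_eq_boxLoc (h : UnitaryGroup.localPi E c (n₁ + n₁) JD₁ v) :
    s (blkLoc F E c v n₁ n₂ hJD₁ hJD h) =
      boxLoc F v n₁ n₂ (restrictBlk F E c v n₁ n₂ hJD₁ hJD hcδ hδ hd hT₁ hT₂ hT₂d s hs h, 1) := by
  refine MpPsi.ext_of_proj_of_toOp ?_ ?_
  · rw [proj_boxLoc, map_one, map_one, mul_one, proj_restrictBlk, hs, iota_blkLoc F E c v n₁ n₂ hJD₁ hJD hcδ hδ hd hT₁ hT₂]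
  · refine linearEquiv_ext_boxSB (blkIdx n₁ n₂) fun Φ₁ Φ₂ => ?_
    have h1 := toRep_blkLoc_boxSB F E c v n₁ n₂ hJD₁ hJD hcδ hδ hd hT₁ hT₂ hT₂d s hs h Φ₁ Φ₂
    rw [MpPsi.toRep_apply, MpPsi.toRep_apply] at h1
    rw [toOp_boxLoc, boxEquivSB_boxSB, map_one, MpPsi.toOp_apply, MpPsi.toOp_apply]
    exact h1

include hs in
set_option maxHeartbeats 1600000 in -- `LocalMp` vs `MpPsi (schrodingerSB …)` unification at the doubled models
/-- **NORMALISATION TRANSFER.**  If the doubled section `s` of `U(T^𝔻)` satisfies the `P_Δ(T)`-normalisation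
`(ω(m s(p) m⁻¹) Φ)(0) = c(p) Φ(0)` for the BOX implementer `m = j̃(m₁, m₂)`, then its block section `restrictBlk s` satisfies the
`P_Δ(T₁)`-normalisation `(ω(m₁ s₁(p₁) m₁⁻¹) Φ₁)(0) = c(blkLoc p₁) Φ₁(0)` (test vector `Φ₁ ⊠ 1_{𝒪}`; `(Φ₁ ⊠ Φ₂)(0) = Φ₁(0) Φ₂(0)`).
[cite: Kudla1994, §3 Thm. 3.1] [cite: HarrisKudlaSweet1996, §1 (1.16)] -/
theorem parabolic_restrictBlk (m₁ : LocalMp F (n₁ + n₁) (gramD F n₁ T₁) v) (m₂ : LocalMp F (n₂ + n₂) (gramD F n₂ T₂) v)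
    (cT : UnitaryGroup.localPi E c ((n₁ + n₂) + (n₁ + n₂)) JD v → ℂ)
    (hnorm : ∀ p, IsSiegelDelta F E c hcδ hδ hd v (n₁ + n₂) (UnitaryGroup.isSymm_finSum hT₁ hT₂) hJD p →
      ∀ Φ : SchwartzBruhat (Fin ((n₁ + n₂) + (n₁ + n₂)) → (v.adicCompletion F)),
        ((MpPsi.toRep _ (boxLoc F v n₁ n₂ (T₁ := T₁) (T₂ := T₂) (m₁, m₂) * s p *
            (boxLoc F v n₁ n₂ (T₁ := T₁) (T₂ := T₂) (m₁, m₂))⁻¹) Φ :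
            SchwartzBruhat (Fin ((n₁ + n₂) + (n₁ + n₂)) → (v.adicCompletion F))) : (Fin ((n₁ + n₂) + (n₁ + n₂)) → (v.adicCompletion F)) → ℂ) 0 =
          cT p * (Φ : (Fin ((n₁ + n₂) + (n₁ + n₂)) → (v.adicCompletion F)) → ℂ) 0)
    (p₁ : UnitaryGroup.localPi E c (n₁ + n₁) JD₁ v) (hp₁ : IsSiegelDelta F E c hcδ hδ hd v n₁ hT₁ hJD₁ p₁)
    (Φ₁ : SchwartzBruhat (Fin (n₁ + n₁) → (v.adicCompletion F))) :
    ((MpPsi.toRep _ (m₁ * restrictBlk F E c v n₁ n₂ hJD₁ hJD hcδ hδ hd hT₁ hT₂ hT₂d s hs p₁ * m₁⁻¹) Φ₁ :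
        SchwartzBruhat (Fin (n₁ + n₁) → (v.adicCompletion F))) : (Fin (n₁ + n₁) → (v.adicCompletion F)) → ℂ) 0 =
      cT (blkLoc F E c v n₁ n₂ hJD₁ hJD p₁) * (Φ₁ : (Fin (n₁ + n₁) → (v.adicCompletion F)) → ℂ) 0 := by
  have h := hnorm (blkLoc F E c v n₁ n₂ hJD₁ hJD p₁)
    ((isSiegelDelta_blkLoc_iff F E c v n₁ n₂ hJD₁ hJD hcδ hδ hd hT₁ hT₂ p₁).2 hp₁)
    (boxSB (v.adicCompletion F) (blkIdx n₁ n₂) Φ₁ (unitVec F (Fin (n₂ + n₂)) v))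
  -- the conjugate is the box of the conjugates
  rw [apply_blkLoc_eq_boxLoc F E c v n₁ n₂ hJD₁ hJD hcδ hδ hd hT₁ hT₂ hT₂d s hs p₁, ← map_mul, ← map_inv, ← map_mul,
    Prod.mk_mul_mk, Prod.inv_mk, Prod.mk_mul_mk, mul_one, mul_inv_cancel, toRep_boxLoc_boxSB, map_one,
    Module.End.one_apply, coe_boxSB, coe_boxSB] at h
  have h0 : ((unitVec F (Fin (n₂ + n₂)) v : SchwartzBruhat (Fin (n₂ + n₂) → (v.adicCompletion F))) : (Fin (n₂ + n₂) → (v.adicCompletion F)) → ℂ) 0 = 1 :=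
    unitVec_apply_of_mem fun i _ => (v.adicCompletionIntegers F).zero_mem
  simp only [resL_zero, resR_zero, h0, mul_one] at h
  exact h

end Transfer

/-! ## §5 Lagrangian bookkeeping: the box of two movers of `ℓ_Δ` onto `ℓ_Y` is a mover -/

omit [NumberField E] [Algebra.IsQuadraticExtension F E] in
/-- membership in `ℓ_Δ`, raw form. [cite: HarrisKudlaSweet1996, §1 (1.11)] -/
theorem mem_deltaLagrangian_iff' {n : ℕ} (p : (Fin (n + n) → (v.adicCompletion F)) × (Fin (n + n) → (v.adicCompletion F))) :
    p ∈ deltaLagrangian F v n ↔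
      ∀ i : Fin n, p.1 (e₂ n (Sum.inl i)) = p.1 (e₂ n (Sum.inr i)) ∧ p.2 (e₂ n (Sum.inl i)) = p.2 (e₂ n (Sum.inr i)) :=
  Iff.rfl

omit [NumberField E] [Algebra.IsQuadraticExtension F E] in
/-- **`ℓ_Δ(T₁ ⊕ᶠ T₂) = ℓ_Δ(T₁) × ℓ_Δ(T₂)` through `splitW blkIdx`.** [cite: Kudla1994, §2–§3] -/
theorem deltaLagrangian_eq_comap_prod :
    deltaLagrangian F v (n₁ + n₂) =
      ((deltaLagrangian F v n₁).prod (deltaLagrangian F v n₂)).comap (splitW (K := (v.adicCompletion F)) (blkIdx n₁ n₂)).toLinearMap := by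
  ext p
  rw [Submodule.mem_comap, Submodule.mem_prod, mem_deltaLagrangian_iff', mem_deltaLagrangian_iff', mem_deltaLagrangian_iff']
  simp only [LinearEquiv.coe_coe, splitW_apply, resL_apply, resR_apply, blkIdx_inl_inl, blkIdx_inl_inr, blkIdx_inr_inl,
    blkIdx_inr_inr]
  constructor
  · intro h
    exact ⟨fun k => h _, fun k => h _⟩
  · rintro ⟨h₁, h₂⟩ i
    obtain ⟨i, rfl⟩ := (finSumFinEquiv : Fin n₁ ⊕ Fin n₂ ≃ Fin (n₁ + n₂)).surjective i
    rcases i with k | k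
    · exact h₁ k
    · exact h₂ k

omit [NumberField E] [Algebra.IsQuadraticExtension F E] in
/-- **`ℓ_Y = ℓ_Y × ℓ_Y` through `splitW blkIdx`** (`ℓ_Y = 0 × F_v^N`: the first coordinate vanishes iff both of its restrictions do).
[cite: Kudla1994, §3] -/
theorem lagrangianY_eq_comap_prod {N N₁ N₂ : ℕ} (e : Fin N₁ ⊕ Fin N₂ ≃ Fin N) :
    lagrangianY F N v = ((lagrangianY F N₁ v).prod (lagrangianY F N₂ v)).comap (splitW (K := (v.adicCompletion F)) e).toLinearMap := by
  ext p
  simp only [lagrangianY, Submodule.mem_comap, Submodule.mem_prod, Submodule.mem_bot, Submodule.mem_top, and_true,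
    LinearEquiv.coe_coe, splitW_apply]
  constructor
  · intro h
    rw [h, resL_zero, resR_zero]
    exact ⟨rfl, rfl⟩
  · rintro ⟨h₁, h₂⟩
    rw [← glue_resL_resR e p.1, h₁, h₂, glue_zero]

omit [NumberField E] [Algebra.IsQuadraticExtension F E] in
/-- `(g₁ ⊕ 1)(1 ⊕ g₂) = splitW⁻¹ ∘ (g₁ × g₂) ∘ splitW` on vectors. [cite: Kudla1984, §1] -/
theorem inlW_inrW_apply {ι₁ ι₂ ι : Type*} (e : ι₁ ⊕ ι₂ ≃ ι)
    (g₁ : ((ι₁ → (v.adicCompletion F)) × (ι₁ → (v.adicCompletion F))) ≃ₗ[(v.adicCompletion F)] ((ι₁ → (v.adicCompletion F)) × (ι₁ → (v.adicCompletion F))))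
    (g₂ : ((ι₂ → (v.adicCompletion F)) × (ι₂ → (v.adicCompletion F))) ≃ₗ[(v.adicCompletion F)] ((ι₂ → (v.adicCompletion F)) × (ι₂ → (v.adicCompletion F)))) (w : (ι → (v.adicCompletion F)) × (ι → (v.adicCompletion F))) :
    inlW e g₁ (inrW e g₂ w) = (splitW e).symm (g₁ (splitW e w).1, g₂ (splitW e w).2) := by
  simp only [inlW_apply, inrW_apply, resL_glue, resR_glue, splitW_apply, splitW_symm_apply]

omit [NumberField E] [Algebra.IsQuadraticExtension F E] in
/-- transport of `map`/`comap` through the splitting: `map (splitW⁻¹ ∘ P ∘ splitW) (comap splitW K) = comap splitW (map P K)`.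
[cite: Kudla1984, §1] -/
theorem map_conj_comap_splitW {ι₁ ι₂ ι : Type*} (e : ι₁ ⊕ ι₂ ≃ ι)
    (P : (((ι₁ → (v.adicCompletion F)) × (ι₁ → (v.adicCompletion F))) × ((ι₂ → (v.adicCompletion F)) × (ι₂ → (v.adicCompletion F)))) →ₗ[(v.adicCompletion F)] (((ι₁ → (v.adicCompletion F)) × (ι₁ → (v.adicCompletion F))) × ((ι₂ → (v.adicCompletion F)) × (ι₂ → (v.adicCompletion F)))))
    (f : ((ι → (v.adicCompletion F)) × (ι → (v.adicCompletion F))) →ₗ[(v.adicCompletion F)] ((ι → (v.adicCompletion F)) × (ι → (v.adicCompletion F))))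
    (hf : ∀ w, f w = (splitW e).symm (P (splitW e w)))
    (K : Submodule (v.adicCompletion F) (((ι₁ → (v.adicCompletion F)) × (ι₁ → (v.adicCompletion F))) × ((ι₂ → (v.adicCompletion F)) × (ι₂ → (v.adicCompletion F))))) :
    (K.comap (splitW (K := (v.adicCompletion F)) e).toLinearMap).map f = (K.map P).comap (splitW (K := (v.adicCompletion F)) e).toLinearMap := by
  ext w
  simp only [Submodule.mem_map, Submodule.mem_comap, LinearEquiv.coe_coe]
  constructor
  · rintro ⟨u, hu, rfl⟩
    exact ⟨splitW e u, hu, by rw [hf, LinearEquiv.apply_symm_apply]⟩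
  · rintro ⟨k, hk, hkw⟩
    refine ⟨(splitW e).symm k, by rwa [LinearEquiv.apply_symm_apply], ?_⟩
    rw [hf, LinearEquiv.apply_symm_apply, hkw, LinearEquiv.symm_apply_apply]

omit [NumberField E] [Algebra.IsQuadraticExtension F E] in
/-- **THE BOX OF TWO MOVERS IS A MOVER**: if `π(m_j) ℓ_Δ(T_j) = ℓ_Y` (`j = 1, 2`) then `(π(m₁) ⊕ π(m₂)) ℓ_Δ(T₁ ⊕ᶠ T₂) = ℓ_Y`.
[cite: Kudla1994, §3] [cite: HarrisKudlaSweet1996, §1 (1.11)] -/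
theorem map_boxPair_deltaLagrangian (g₁ : LocalSp F (n₁ + n₁) (gramD F n₁ T₁) v) (g₂ : LocalSp F (n₂ + n₂) (gramD F n₂ T₂) v)
    (h₁ : (deltaLagrangian F v n₁).map (toLin F v g₁) = lagrangianY F (n₁ + n₁) v)
    (h₂ : (deltaLagrangian F v n₂).map (toLin F v g₂) = lagrangianY F (n₂ + n₂) v) :
    (deltaLagrangian F v (n₁ + n₂)).map (toLin F v
        (spInl (blkIdx n₁ n₂) (localGram F (n₁ + n₁) (gramD F n₁ T₁) v) (localGram F (n₂ + n₂) (gramD F n₂ T₂) v)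
            (localGram_gramD_finSum F v n₁ n₂) g₁ *
          spInr (blkIdx n₁ n₂) (localGram F (n₁ + n₁) (gramD F n₁ T₁) v) (localGram F (n₂ + n₂) (gramD F n₂ T₂) v)
            (localGram_gramD_finSum F v n₁ n₂) g₂)) =
      lagrangianY F ((n₁ + n₂) + (n₁ + n₂)) v := by
  rw [deltaLagrangian_eq_comap_prod F v n₁ n₂, lagrangianY_eq_comap_prod F v (blkIdx n₁ n₂),
    map_conj_comap_splitW F v (blkIdx n₁ n₂) ((toLin F v g₁).prodMap (toLin F v g₂)) _ (fun w => ?_),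
    LinearMap.prodMap_map_prod, h₁, h₂]
  rw [toLin, Subgroup.coe_mul, LinearEquiv.coe_coe, LinearEquiv.mul_apply, coe_spInl, coe_spInr, inlW_inrW_apply,
    LinearMap.prodMap_apply]
  rfl


end DoubledBlock

end Literature.NumberTheory.GelbartRogawski1991.UnitaryDualPair.LocalSplitting

end
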